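import Summits.ResolutionOfSingularities.ResolutionOfSingularities.Theorems.WildConesCampaignW46ForcedAtomPermissible
import Summits.ResolutionOfSingularities.ResolutionOfSingularities.Theorems.MarkedTransferCampaignW46FiniteExitBound
import Summits.ResolutionOfSingularities.ResolutionOfSingularities.Theorems.WildConesCampaignW46ClassicalMuDrop
import HarnessLib

/-!
# [OURS · L1 W4.6, rung (i) WITH A NUMBER — surfaces `z^p = a(x,y)` in 3-space, plane curves, and `p = 2` in all
# dimensions] THE FINITE-SEQUENCE EXIT BOUND in the forced-atom regime: `CampaignW46.FinLocalExitBound (Regime.forcedAtom n)`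
# for `n ≤ 2 ∨ p = 2`, over every algebraically closed field of characteristic `p`; the bound is the Milnor number
# (cell res-hironaka, LADDER-RESOLUTION rung L, D-0089; slot W4.6, seat res-L1-s46-pv-2 gen 3; host route `WildCones`,
# crux `ClassicalRegimes` stmt-ResolutionOfSingularities-16884, `--supports … --as helper`)

HONEST FRAMING. Everything here is OURS. NOTHING below is a statement of H. Hironaka's manuscript [Hironaka2017] and
nothing asserts that any statement of it holds: res-L1-type-o1's finite permissible sequences and exit-bound shape
(`CampaignW46.FinPermissibleRun`, `FinLocalExitBound`, `Theorems/MarkedTransferCampaignW46FiniteExitBound.lean`, the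
WORDING OF RECORD of rung (i-a)′, OURS-desk #71), o1's regime `Regime.forcedAtom` (p517839) and the typed candidate
carriers of row 001 enter as DEFINITIONS; no FACT-LIST premise is used. AI review is weaker than expert review.

## What is proved

`CampaignW46.ForcedAtom.finLocalExitBound_forcedAtom (hn : 0 < n) (hreg : n ≤ 2 ∨ p = 2) :
  FinLocalExitBound (Regime.forcedAtom n)` over an algebraically closed field `K` of characteristic `p`. The bound
`β(A, E, x)` is EXPLICIT: the Milnor number `μ(c₀) = dim_K K⟦u⟧/(∂ ser c₀)` of (a choice of) a presentation of `J_x` by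
a unit times an atom `z^p − ser c₀`, and `0` where there is none. Content: for every FINITE §2.1-permissible sequence
`Z_len → ⋯ → Z_1 → Z_0` all of whose stages lie in `Regime.forcedAtom n`, every point `x` of `Z_0` and every set `s` of
indices `m < len` whose centre `D_m` meets the fibre over `x`: `#s ≤ β(A₀, E₀, x)`. Proof: in the regime every centre is
the singular point `ξ_m` and lies over `ξ_0` (so `s = ∅` unless `x = ξ_0`); starting from the CHOSEN presentation at `ξ_0`
the one step of this seat's dictionary (`exists_presentation_transform_of_isBlowup`, raw blow-up data) produces, stage by
stage, presentations by the successive states of ONE run of route `WildCones`' coefficient dynamics, all isolated of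
multiplicity `p` (`transform_mem_pow_iff_multP`, the regime's isolatedness clause); along such a run the Milnor number
drops at every step in the classical regimes (`WildCones.classicalRegimes_exit_le_mu`, p480678: `n ≤ 2` every `p` — this
seat's Huneke–Swanson intertwiner for surfaces, p480270 — or `p = 2` every `n`, res-L1-s46-pv-4), so `len ≤ μ(c₀)`.
Corollaries: `permissiblyTerminates_forcedAtom'` (re-derivation of the résumé-free rung in the classical regimes through
o1's `permissiblyTerminates_of_finLocalExitBound`), and the all-binders form `finLocalExitBound_forcedAtom_all`.

NOT claimed: `n ≥ 3` with `p` odd (no Milnor monotonicity there: this seat's dictionary gives termination, p523688, but no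
number); `n = 0`; perfect non-closed `K`. References: this seat's p516034 / p523688 (one step, induction), p480678 /
p480270 (`classicalRegimes_exit_le_mu`), res-L1-type-o1 p488284 (`FinLocalExitBound`), p517839. [folklore]
-/

noncomputable section

-- single-problem summit: the doubled namespace component `ResolutionOfSingularities` is forced
set_option linter.dupNamespace false

open scoped BigOperators Classical
open MvPowerSeries IsLocalRing

namespace Summit.ResolutionOfSingularities.ResolutionOfSingularities.Theorems

namespace CampaignW46.ForcedAtom

open CategoryTheory AlgebraicGeometry TopologicalSpace
open Literature.AlgebraicGeometry.Resolution
open Literature.AlgebraicGeometry.Hironaka2017.S02Preliminaries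
open Literature.AlgebraicGeometry.Hironaka2017.Datum
open Scheme.IdealSheafData
open WildCones
open CampaignW46.AtomGerm

variable {p : ℕ} [Fact p.Prime] {K : Type} [Field K] [CharP K p] {n : ℕ}

omit [Fact p.Prime] [CharP K p] in
/-- Pure bookkeeping: runs of the coefficient calculus along two words that agree below `k` agree at stage `k`. [folklore] -/
theorem run_congr (c₀ : (Fin n → ℕ) → K) {i i' : ℕ → Fin n} {t t' : ℕ → Fin n → K} :
    ∀ k : ℕ, (∀ j < k, i j = i' j) → (∀ j < k, t j = t' j) → run p n K c₀ i t k = run p n K c₀ i' t' k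
  | 0, _, _ => rfl
  | k + 1, hi, ht => by
    change step p n K (i k) (t k) (run p n K c₀ i t k) = step p n K (i' k) (t' k) (run p n K c₀ i' t' k)
    rw [run_congr c₀ k (fun j hj => hi j (Nat.lt_succ_of_lt hj)) (fun j hj => ht j (Nat.lt_succ_of_lt hj)),
      hi k (Nat.lt_succ_self k), ht k (Nat.lt_succ_self k)]

variable [IsAlgClosed K]

/-- [OURS · L1 W4.6 rung (i) WITH A NUMBER (surfaces in 3-space `n = 2`, plane curves `n = 1`, every `p`; all `n` at
`p = 2`); replaces the role of Th. 16.13 p.87 l.25–28 («by applying Th.(16.6) … repeatedly but FINITELY MANY times») of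
H. Hironaka's ms. (2017) read, résumé-free, on FINITE §2.1-permissible sequences restricted to the forced-atom regime, in
the exit-bound form of record (rung (i-a)′, `FinLocalExitBound`); NOT a statement of the manuscript] **In the forced-atom
regime the number of blow-ups of a permissible sequence over a point is bounded by the Milnor number of the atom at that
point** (`K` algebraically closed of characteristic `p`, `0 < n`, `n ≤ 2 ∨ p = 2`). [folklore] -/
theorem finLocalExitBound_forcedAtom (hn : 0 < n) (hreg : n ≤ 2 ∨ p = 2) :
    FinLocalExitBound (Regime.forcedAtom (p := p) (K := K) n) := by
  have hp : p.Prime := Fact.out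
  -- the bound: the Milnor number of a chosen atom presentation at `x`, if any
  refine ⟨fun A E x =>
    if h : ∃ (E₀ : AdicCompletion (maximalIdeal (A.Z.presheaf.stalk x)) (A.Z.presheaf.stalk x) ≃+*
          MvPowerSeries (Option (Fin n)) K)
        (f₀ : A.Z.presheaf.stalk x) (c₀ : (Fin n → ℕ) → K) (w₀ : MvPowerSeries (Option (Fin n)) K),
        stalkIdeal E.J x = Ideal.span {f₀} ∧ IsUnit w₀ ∧
          E₀ (algebraMap _ _ f₀) = w₀ * ((X none : MvPowerSeries (Option (Fin n)) K) ^ p -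
            rename (some : Fin n → Option (Fin n)) (ser p n K c₀))
      then mu p n K h.choose_spec.choose_spec.choose else 0, ?_⟩
  intro r hr x s hs
  -- the empty case
  rcases s.eq_empty_or_nonempty with hs0 | ⟨m₀, hm₀⟩
  · rw [hs0, Finset.card_empty]
    exact Nat.zero_le _
  have hlen : 0 < r.len := lt_of_le_of_lt (Nat.zero_le m₀) (hs m₀ hm₀).1
  -- singular points and centres of the stages `k < len`
  have hS : ∀ k, k ≤ r.len → (r.E k).sing.Subsingleton := fun k hk => (hr k hk).2.1
  have hcen : ∀ k, k < r.len → ∃ ξ : (r.A k).Z, (r.D k : Set (r.A k).Z) = {ξ} ∧ (r.E k).sing = {ξ} := by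
    intro k hk
    obtain ⟨ξ, hξD⟩ := (r.permissible k hk).irreducible.nonempty
    have hξS : ξ ∈ (r.E k).sing := (r.permissible k hk).subset_sing hξD
    refine ⟨ξ, ?_, (hS k hk.le).eq_singleton_of_mem hξS⟩
    exact (Set.subsingleton_of_subset_singleton
      (((hS k hk.le).eq_singleton_of_mem hξS) ▸ (r.permissible k hk).subset_sing)).eq_singleton_of_mem hξD
  choose ξ hξ using hcen
  have hξS : ∀ k (hk : k < r.len), ξ k hk ∈ (r.E k).sing := fun k hk => by
    rw [(hξ k hk).2]
    exact Set.mem_singleton _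
  have hcl : ∀ k (hk : k < r.len), IsClosed ({ξ k hk} : Set (r.A k).Z) := fun k hk => by
    rw [← (hξ k hk).1]
    exact (r.D k).isClosed
  -- consecutive singular points lie over each other
  have hπξ : ∀ k (hk : k + 1 < r.len), r.π k (ξ (k + 1) hk) = ξ k (Nat.lt_of_succ_lt hk) := by
    intro k hk
    haveI : IsLocallyNoetherian (r.A (k + 1)).Z := ambient_isLocallyNoetherian _
    have hk' : k < r.len := Nat.lt_of_succ_lt hk
    have h1 : ξ (k + 1) hk ∈ ((r.E k).transform (r.π k) (r.D k)).sing := by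
      rw [← r.E_succ k hk']
      exact hξS (k + 1) hk
    exact hS k hk'.le (sing_subset_of_transform (r.blowup k hk') (r.E k) (r.permissible k hk').subset_sing h1)
      (hξS k hk')
  have hdown : ∀ k (hk : k < r.len), r.down k (ξ k hk) = ξ 0 hlen := by
    intro k
    induction k with
    | zero => intro hk; rfl
    | succ k ih =>
      intro hk
      change (r.π k ≫ r.down k) (ξ (k + 1) hk) = ξ 0 hlen
      rw [Scheme.Hom.comp_apply, hπξ k hk, ih]
  -- `x` is the singular point of stage `0`
  have hx : x = ξ 0 hlen := by
    obtain ⟨hm₀len, y, hy, hyx⟩ := hs m₀ hm₀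
    rw [(hξ m₀ hm₀len).1, Set.mem_singleton_iff] at hy
    rw [← hyx, hy, hdown m₀ hm₀len]
  subst hx
  -- the chosen presentation at `ξ 0`
  have hex := ((hr 0 hlen.le).2.2 (ξ 0 hlen) (hξS 0 hlen)).2.1
  dsimp only
  rw [dif_pos hex]
  set c₀ := hex.choose_spec.choose_spec.choose with hc₀def
  have hpres₀ := hex.choose_spec.choose_spec.choose_spec
  obtain ⟨w₀, hJ0, hw0, hf0⟩ := hpres₀
  -- multiplicity `p` of a presented atom at a singular point of a stage in the regime
  have hmult : ∀ (k : ℕ) (hk : k < r.len)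
      (E₀ : AdicCompletion (maximalIdeal ((r.A k).Z.presheaf.stalk (ξ k hk))) ((r.A k).Z.presheaf.stalk (ξ k hk)) ≃+*
        MvPowerSeries (Option (Fin n)) K)
      (f₀ : (r.A k).Z.presheaf.stalk (ξ k hk)) (a : (Fin n → ℕ) → K) (w : MvPowerSeries (Option (Fin n)) K),
      stalkIdeal (r.E k).J (ξ k hk) = Ideal.span {f₀} → IsUnit w →
        E₀ (algebraMap _ _ f₀) = w * ((X none : MvPowerSeries (Option (Fin n)) K) ^ p -
          rename (some : Fin n → Option (Fin n)) (ser p n K a)) → Isol p n K a ∧ MultP p n K a := by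
    intro k hk E₀ f₀ a w hJ hw hf₀
    haveI : IsRegularLocalRing ((r.A k).Z.presheaf.stalk (ξ k hk)) := ambient_isRegular (r.A k) _
    have hI : Isol p n K a := ((hr k hk.le).2.2 (ξ k hk) (hξS k hk)).2.2 E₀ f₀ a w hJ hw hf₀
    have hf₀𝔪 : f₀ ∈ maximalIdeal ((r.A k).Z.presheaf.stalk (ξ k hk)) ^ p := by
      have h := hξS k hk
      change ((r.E k).b : ℕ∞) ≤ idealOrder (r.E k).J _ at h
      rw [le_idealOrder_iff, hJ, Ideal.span_singleton_le_iff_mem, (hr k hk.le).1] at h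
      exact h
    exact ⟨hI, (transform_mem_pow_iff_multP E₀ hw a hf₀).2.mpr ⟨ThreefoldsCharTwo.ser_ne_zero_of_isol hn hI, hf₀𝔪⟩⟩
  -- presentations at `ξ_k`, `k < len`
  let P : ∀ k, k < r.len → Type := fun k hk =>
    Σ' (E₀ : AdicCompletion (maximalIdeal ((r.A k).Z.presheaf.stalk (ξ k hk))) ((r.A k).Z.presheaf.stalk (ξ k hk)) ≃+*
        MvPowerSeries (Option (Fin n)) K)
      (f₀ : (r.A k).Z.presheaf.stalk (ξ k hk)) (a : (Fin n → ℕ) → K) (w : MvPowerSeries (Option (Fin n)) K),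
      stalkIdeal (r.E k).J (ξ k hk) = Ideal.span {f₀} ∧ IsUnit w ∧
        E₀ (algebraMap _ _ f₀) = w * ((X none : MvPowerSeries (Option (Fin n)) K) ^ p -
          rename (some : Fin n → Option (Fin n)) (ser p n K a))
  -- one run of the coefficient dynamics presenting every stage `k < len`
  have H : ∀ k (hk : k < r.len), ∃ (i : ℕ → Fin n) (t : ℕ → Fin n → K) (q : P k hk),
      run p n K c₀ i t k = q.2.2.1 ∧
        ∀ j ≤ k, Isol p n K (run p n K c₀ i t j) ∧ MultP p n K (run p n K c₀ i t j) := by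
    intro k
    induction k with
    | zero =>
      intro hk
      refine ⟨fun _ => ⟨0, hn⟩, fun _ _ => 0, ⟨hex.choose, hex.choose_spec.choose, c₀, w₀, hJ0, hw0, hf0⟩, rfl, ?_⟩
      intro j hj
      obtain rfl : j = 0 := Nat.le_zero.mp hj
      exact hmult 0 hk hex.choose hex.choose_spec.choose c₀ w₀ hJ0 hw0 hf0
    | succ k ih =>
      intro hk
      have hk' : k < r.len := Nat.lt_of_succ_lt hk
      obtain ⟨i, t, ⟨E₀, f₀, a, w, hJ, hw, hf₀⟩, hrun, hgood⟩ := ih hk'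
      have hd := ((hr k hk'.le).2.2 (ξ k hk') (hξS k hk')).1
      have hξ' : ξ (k + 1) hk ∈ ((r.E k).transform (r.π k) (r.D k)).sing := by
        rw [← r.E_succ k hk']
        exact hξS (k + 1) hk
      obtain ⟨i₀, τ, E₀', f₀', w', hJ', hw', hf₀'⟩ := exists_presentation_transform_of_isBlowup (r.π k) (r.D k)
        (r.blowup k hk') (r.hom_eq k hk') (hr k hk'.le).1 (hS k hk'.le) (hξS k hk') (hξ k hk').1 hd E₀ f₀ a w hJ hw
        hf₀ (hmult k hk' E₀ f₀ a w hJ hw hf₀).2 hξ' (hcl (k + 1) hk)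
      have hJ'' : stalkIdeal (r.E (k + 1)).J (ξ (k + 1) hk) = Ideal.span {f₀'} := by
        rw [r.E_succ k hk']
        exact hJ'
      -- the extended word
      refine ⟨fun j => if j = k then i₀ else i j, fun j => if j = k then τ else t j,
        ⟨E₀', f₀', step p n K i₀ τ a, w', hJ'', hw', hf₀'⟩, ?_, ?_⟩
      · have hagree : run p n K c₀ (fun j => if j = k then i₀ else i j) (fun j => if j = k then τ else t j) k =
            run p n K c₀ i t k :=
          run_congr c₀ k (fun j hj => if_neg (Nat.ne_of_lt hj)) (fun j hj => if_neg (Nat.ne_of_lt hj))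
        change step p n K (if k = k then i₀ else i k) (if k = k then τ else t k)
          (run p n K c₀ (fun j => if j = k then i₀ else i j) (fun j => if j = k then τ else t j) k) = _
        rw [if_pos rfl, if_pos rfl, hagree, hrun]
      · intro j hj
        rcases Nat.lt_or_ge j (k + 1) with hjk | hjk
        · have hjk' : j ≤ k := Nat.lt_succ_iff.mp hjk
          have hagree_j : run p n K c₀ (fun l => if l = k then i₀ else i l) (fun l => if l = k then τ else t l) j =
              run p n K c₀ i t j :=
            (run_congr c₀ j (i' := fun l => if l = k then i₀ else i l) (t' := fun l => if l = k then τ else t l)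
              (fun l hl => (if_neg (Nat.ne_of_lt (lt_of_lt_of_le hl hjk'))).symm)
              (fun l hl => (if_neg (Nat.ne_of_lt (lt_of_lt_of_le hl hjk'))).symm)).symm
          rw [hagree_j]
          exact hgood j hjk'
        · have hj' : j = k + 1 := le_antisymm hj hjk
          subst hj'
          have hagree : run p n K c₀ (fun j => if j = k then i₀ else i j) (fun j => if j = k then τ else t j) k =
              run p n K c₀ i t k :=
            run_congr c₀ k (fun j hj => if_neg (Nat.ne_of_lt hj)) (fun j hj => if_neg (Nat.ne_of_lt hj))
          have hstate : run p n K c₀ (fun j => if j = k then i₀ else i j) (fun j => if j = k then τ else t j)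
              (k + 1) = step p n K i₀ τ a := by
            change step p n K (if k = k then i₀ else i k) (if k = k then τ else t k)
              (run p n K c₀ (fun j => if j = k then i₀ else i j) (fun j => if j = k then τ else t j) k) = _
            rw [if_pos rfl, if_pos rfl, hagree, hrun]
          rw [hstate]
          exact hmult (k + 1) hk E₀' f₀' (step p n K i₀ τ a) w' hJ'' hw' hf₀'
  -- the last blown-up stage `len - 1` and the Milnor bound
  obtain ⟨i, t, -, -, hgood⟩ := H (r.len - 1) (Nat.sub_lt hlen Nat.one_pos)
  obtain ⟨m, hmμ, hbad⟩ := classicalRegimes_exit_le_mu hp hn hreg K c₀ i t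
  have hlenm : r.len ≤ m := by
    by_contra hlt
    exact hbad (hgood m (by omega))
  -- `s ⊆ {0, …, len - 1}`
  have hcard : s.card ≤ r.len := by
    calc s.card ≤ (Finset.range r.len).card :=
          Finset.card_le_card fun m hm => Finset.mem_range.mpr (hs m hm).1
      _ = r.len := Finset.card_range _
  exact hcard.trans (hlenm.trans hmμ)

/-- [OURS · L1 W4.6 rung (i); NOT a statement of the manuscript] The résumé-free rung in the classical regimes,
RE-DERIVED from the exit bound through o1's `permissiblyTerminates_of_finLocalExitBound` (`Sing` is finite in the
forced-atom regime): no infinite §2.1-permissible sequence inside `Regime.forcedAtom n`, `n ≤ 2 ∨ p = 2` (the general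
`0 < n` case is `permissiblyTerminates_forcedAtom`, p523688). [folklore] -/
theorem permissiblyTerminates_forcedAtom' (hn : 0 < n) (hreg : n ≤ 2 ∨ p = 2) :
    PermissiblyTerminates (Regime.forcedAtom (p := p) (K := K) n) :=
  permissiblyTerminates_of_finLocalExitBound (fun _ _ h => h.2.1.finite) (finLocalExitBound_forcedAtom hn hreg)

omit [Fact p.Prime] [CharP K p] [IsAlgClosed K] in
/-- [OURS · L1 W4.6 rung (i) WITH A NUMBER; NOT a statement of the manuscript] The exit bound with every binder explicit:
for every prime `p`, every algebraically closed field `K` of characteristic `p` and every `n ≥ 1` with `n ≤ 2 ∨ p = 2`,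
`FinLocalExitBound (Regime.forcedAtom n)`. [folklore] -/
theorem finLocalExitBound_forcedAtom_all :
    ∀ (p : ℕ) [Fact p.Prime] (K : Type) [Field K] [CharP K p] [IsAlgClosed K] (n : ℕ), 0 < n → (n ≤ 2 ∨ p = 2) →
      FinLocalExitBound (Regime.forcedAtom (p := p) (K := K) n) :=
  fun _ _ _ _ _ _ _ hn hreg => finLocalExitBound_forcedAtom hn hreg

end CampaignW46.ForcedAtom

end Summit.ResolutionOfSingularities.ResolutionOfSingularities.Theorems

end
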